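import Summits.HodgeConjecture.CorCM.GaloisSplitInvolutionTypes
import HarnessLib

/-!
# Doubled types for an abelian subgroup of index two: `c ∉ ⟨x²⟩` already forces a singular odd block (the EASY half of BAD)

COR-CM (cell `pub-hodgecm2`), binder seat b04 (gens 29–30), count-neutral own lane «Galois-CM-type classification» (which Galois CM
fields `(G, c)` have ALL primitive CM types nondegenerate = GOOD, vs. a primitive degenerate type = BAD).  KERNEL ONLY: theorems;
no definition, no named fact, no `sorry`.  `HC_CM` is neither used nor claimed.

SETTING (as in `CorCM/GaloisSplitInvolutionTypes`, whose case `x² = 1` this file generalises).  `G₀ = i(A) ⊔ i(A)x` with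
`i : A ↪ G₀` abelian of index two, `x i(u) = i(θ u) x`, and now `x² = i(q)` for an ARBITRARY `q ∈ A`; complex conjugation
`c ∈ A` central (`θ c = c`), `c² = 1`.  For a half `S ⊂ A` (`a ∈ S ↔ ca ∉ S`) the DOUBLED TYPE is `T = i(S) ⊔ i(S)x`.
In gen 28's two-sheet calculus (`CorCM/TwoSheetDegenerate`, `TwoSheet.exists_annihilator_of_det_eq_zero`) the block of `T` at an
odd character `χ` of `A` (`χ(c) = −1`) has determinant `Ŝ(χ)Ŝ(χθ) − χ(q)·Ŝ(χ)Ŝ(χθ) = (1 − χ(q))·Ŝ(χ)Ŝ(χθ)`, so it is SINGULAR as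
soon as `χ(q) = 1`.  An odd character with `χ(q) = 1` is a character of `A/⟨q⟩` odd at the image of `c`, and it exists iff
**`c ∉ ⟨q⟩`** (§1 `exists_odd_character_apply_eq_one`, from `Σ_χ χ(c̄) = 0` on the quotient).  Hence:

THEOREM (§2 **`exists_simple_degenerate_of_index_two_doubled`**).  `K` Galois CM, `e : Gal(K/ℚ) ≃* G₀` as above with
`x² = i(q)` and `c ∉ ⟨q⟩`; if `A` has a CM half `S` which is APERIODIC (`aS ≠ S`, `a ≠ 1`) and `θ`-ASYMMETRIC (`a·θ(S) ≠ S` for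
all `a`), then `K` is BAD: the doubled type is PRIMITIVE and DEGENERATE, realised by a SIMPLE abelian variety of dimension
`|G₀|/2` with CM by `K` carrying a rational `(p,p)` class outside the divisor ring on some power.  The split theorem is the case
`q = 1` (`c ∉ ⟨1⟩ ⟺ c ≠ 1`) — `CorCM/GaloisSplitInvolutionTypes`, `exists_simple_degenerate_of_split_involution`.

THE DICHOTOMY THIS DRAWS (for `(G, c)` with an abelian subgroup `A` of index `2`; every `x ∉ A` has `x² ∈ A`):
* EASY side — some `x ∉ A` with `c ∉ ⟨x²⟩`: BAD as soon as an aperiodic `θ_x`-asymmetric half exists (split involutions: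
  `D₄ × C_n`, `D₈/SD₁₆/M₁₆ × C_n` — `CorCM/GaloisDihedralTimesCyclicDegenerate`, `CorCM/GaloisSemidihedralModularTimesCyclicDegenerate`;
  non-split: `C₄ ⋊ C₄` with `c ∈ {y², x²y²}`, `Q₈ × C₂` and `D₄ × C₂` with `c` off the square class, and all their products with
  `C_n` — consistent with gen 17's order-16 census, where exactly these rows are BAD);
* HARD side — `c ∈ ⟨x²⟩` for EVERY `x ∉ A`: `C_p ⋊ C₈` (`x² = g²`, `c = g⁴`), `Q₈ × C_p` (`x² = −1 = c`), `Q_{2^k}`, the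
  non-split metacyclic groups of gen 22 — there the odd blocks carry `χ(q) = −1`, the determinant is `Ŝ(χ)Ŝ(χθ) + Ŝ'(χ)Ŝ'(χθ)`,
  and degeneracy is the ARITHMETIC question of `μ₄`-norm pairs / sums of two squares in `ℚ(ζ)` (gens 25–29).

## References

* [Kubota1965] T. Kubota, *On the field extension by complex multiplication*, Trans. AMS 118 (1965), §2, §4 Lemma 2.
* [Shimura1998] G. Shimura, *Abelian Varieties with Complex Multiplication and Modular Functions*, §6.2 Thm. 3, §8.2 Prop. 26.
* [Gordon1999HodgeAVSurvey] B. B. Gordon, *A survey of the Hodge conjecture for abelian varieties*, Thm. 6.4, §9.3.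
-/

noncomputable section

open CategoryTheory CategoryTheory.Limits NumberField
open scoped BigOperators

namespace Summit.HodgeConjecture.CorCM.SplitInvolution

open Literature.NumberTheory.ComplexMultiplication
open Literature.AlgebraicGeometry.Motives (AbelianVariety CMType)
open Literature.AlgebraicGeometry.HodgeTheory
open Literature.AlgebraicGeometry.ComplexMultiplication (IsCMTypeRealisation)
open Literature.AlgebraicGeometry.Pohlmann1968
open Literature.Barriers.HodgeConjecture (divisorClassesSpan)
open Summit.HodgeConjecture.CorCM.GaloisRank
open Summit.HodgeConjecture.CorCM.AbelianSixteen (exists_simple_realisation_of_isPrimitive)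
open AddChar

/-! ## §1 An odd character trivial on `q` (when `c ∉ ⟨q⟩`) and the annihilator -/

section Model

variable {G₀ : Type*} [Group G₀] [DecidableEq G₀]
variable {A : Type*} [CommGroup A] [Fintype A]

/-- **An odd character trivial on `q`**: if `c ∉ ⟨q⟩` and `c² = 1`, some character `χ` of `A` has `χ(q) = 1` and `χ(c) = −1`
(an odd character of `A/⟨q⟩` pulled back). [folklore] -/
theorem exists_odd_character_apply_eq_one {c q : A} (hcq : c ∉ Subgroup.zpowers q) (hcc : c * c = 1) :
    ∃ χ : AddChar (Additive A) ℂ, χ (Additive.ofMul q) = 1 ∧ χ (Additive.ofMul c) = -1 := by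
  classical
  let π : A →* A ⧸ Subgroup.zpowers q := QuotientGroup.mk' (Subgroup.zpowers q)
  have hc1 : π c ≠ 1 := fun h => hcq ((QuotientGroup.eq_one_iff c).1 h)
  have hcc' : π c * π c = 1 := by rw [← map_mul, hcc, map_one]
  haveI : Fintype (A ⧸ Subgroup.zpowers q) := Fintype.ofFinite _
  obtain ⟨ψ, hψ⟩ := exists_odd_character hc1 hcc'
  refine ⟨ψ.compAddMonoidHom (MonoidHom.toAdditive π), ?_, ?_⟩
  · have hq1 : π q = 1 := (QuotientGroup.eq_one_iff q).2 (Subgroup.mem_zpowers q)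
    change ψ (Additive.ofMul (π q)) = 1
    rw [hq1, ofMul_one, map_zero_eq_one]
  · exact hψ

/-- **`c ∉ ⟨x²⟩` ⟹ THE DOUBLED TYPE HAS A SINGULAR ODD BLOCK, hence a non-zero rational annihilator** (the two-sheet determinant at
an odd `χ` with `χ(q) = 1` is `Ŝ(χ)Ŝ(χθ) − χ(q)·Ŝ(χ)Ŝ(χθ) = 0`; gen 28 `TwoSheet.exists_annihilator_of_det_eq_zero`).
[cite: Kubota1965, §4 Lemma 2] -/
theorem exists_annihilator_of_doubled_of_not_mem_zpowers [Fintype G₀] [DecidableEq A] (i : A →* G₀) (hi : Function.Injective i)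
    (x : G₀) (hx : ∀ u, i u ≠ x) (hcov : ∀ g : G₀, (∃ u, g = i u) ∨ (∃ u, g = i u * x)) (θ : A ≃* A)
    (hθ : ∀ u, x * i u = i (θ u) * x) (q : A) (hq : x * x = i q) {c : A} (hcq : c ∉ Subgroup.zpowers q) (hcc : c * c = 1)
    (hθc : θ c = c) (S : Finset A) :
    ∃ b : G₀ → ℚ, b ≠ 0 ∧ (∀ g, b (i c * g) = -b g) ∧
      ∀ g : G₀, ∑ s ∈ S.image i ∪ S.image (fun s => i s * x), b (s * g) = 0 := by
  classical
  obtain ⟨χ, hχq, hχ⟩ := exists_odd_character_apply_eq_one hcq hcc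
  have hmem := doubled_mem_iff i hi x hx S
  exact TwoSheet.exists_annihilator_of_det_eq_zero i hi x hx hcov θ hθ q hq hθc
    (S.image i ∪ S.image (fun s => i s * x)) S S (fun u => ((hmem u).1).symm) (fun u => ((hmem u).2).symm) χ hχ
    (by rw [hχq, one_mul, sub_self])

end Model

/-! ## §2 The Galois dress: `c ∉ ⟨x²⟩` and an aperiodic `θ`-asymmetric half ⟹ BAD -/

section Field

variable {G₀ : Type*} [Group G₀] [Fintype G₀] [DecidableEq G₀]
variable {A : Type*} [CommGroup A] [Fintype A]
variable {K : Type} [Field K] [NumberField K] [IsCMField K] [IsGalois ℚ K]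

/-- **INDEX-TWO DOUBLED TYPE, `c ∉ ⟨x²⟩` ⟹ BAD.**  `K` a Galois CM field, `e : Gal(K/ℚ) ≃* G₀`, `i : A ↪ G₀` abelian of index
two (`G₀ = i(A) ⊔ i(A)x`), `x i(u) = i(θ u) x`, `x² = i(q)`, complex conjugation `e(c̄) = i(c)` with `c ∉ ⟨q⟩`, `c² = 1`,
`θ c = c`.  If `A` has a CM half `S` (`a ∈ S ↔ ca ∉ S`) which is APERIODIC and `θ`-ASYMMETRIC, then `K` has a PRIMITIVE DEGENERATE
CM type — realised by a SIMPLE abelian variety of dimension `|G₀|/2` with CM by `K` carrying a rational `(p,p)` class outside the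
divisor ring on some power. [cite: Kubota1965, §2 and §4 Lemma 2] [cite: Shimura1998, §6.2 Thm. 3 and §8.2 Prop. 26]
[cite: Gordon1999HodgeAVSurvey, Thm. 6.4 and §9.3] -/
theorem exists_simple_degenerate_of_index_two_doubled (e : (K ≃ₐ[ℚ] K) ≃* G₀) (i : A →* G₀) (hi : Function.Injective i)
    (x : G₀) (hx : ∀ u, i u ≠ x) (hcov : ∀ g : G₀, (∃ u, g = i u) ∨ (∃ u, g = i u * x)) (θ : A ≃* A)
    (hθ : ∀ u, x * i u = i (θ u) * x) (q : A) (hq : x * x = i q) {c : A} (hcq : c ∉ Subgroup.zpowers q) (hcc : c * c = 1)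
    (hθc : θ c = c) (hc : e ((IsCMField.complexConj K).restrictScalars ℚ) = i c) (S : Finset A) (hS : ∀ a, a ∈ S ↔ c * a ∉ S)
    (haper : ∀ a : A, a ≠ 1 → ∃ s, ¬ (s ∈ S ↔ a * s ∈ S)) (hasym : ∀ a : A, ∃ s, ¬ (s ∈ S ↔ a * θ s ∈ S)) :
    ∃ (Φ : CMType K) (φ₀ : K →+* ℂ) (X : AbelianVariety ℂ) (ι : 𝓞 K →+* End X)
      (ϑ : K →+* Module.End ℂ (complexBetti X.X 1)),
      IsPrimitive (ℂ ≃+* ℂ) Φ.1 φ₀ ∧ ¬ IsNondegenerate Φ ∧ IsCMTypeRealisation Φ X ι ϑ ∧ X.IsSimple ∧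
      X.dim = Fintype.card G₀ / 2 ∧
      ∃ n q : ℕ, ∃ y : complexBetti (⨁ fun _ : Fin n => X).X (2 * q), IsRationalClass y ∧
        IsOfHodgeType (⨁ fun _ : Fin n => X).dim (⨁ fun _ : Fin n => X).X (2 * q) q q y ∧
        y ∉ divisorClassesSpan (⨁ fun _ : Fin n => X).X (⨁ fun _ : Fin n => X).dim q := by
  classical
  set T : Finset G₀ := S.image i ∪ S.image (fun s => i s * x) with hT_def
  have hcm : ∀ g, g ∈ T ↔ i c * g ∉ T := doubled_cm i hi x hx hcov S hS
  have hprim : ∀ v : G₀, v ≠ 1 → ∃ w, ¬ (w ∈ T ↔ v * w ∈ T) := doubled_leftStabiliser i hi x hx hcov θ hθ S haper hasym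
  obtain ⟨φ₀⟩ := (inferInstance : Nonempty (K →+* ℂ))
  obtain ⟨Φ, hprimΦ, hread⟩ := GaloisTable.exists_isPrimitive_of_tableModel (K := K) (X := G₀)
    (fun a b => a * b) e.toEquiv (fun _ _ => map_mul e _ _) (i c) hc 1 (map_one e) T hcm hprim φ₀
  have hread' : ∀ y, y ∈ T ↔ embOf φ₀ (e.symm y) ∈ Φ.1 := fun y => hread y
  obtain ⟨b, hb0, hb, hbann⟩ :=
    exists_annihilator_of_doubled_of_not_mem_zpowers i hi x hx hcov θ hθ q hq hcq hcc hθc S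
  have hdeg : ¬ IsNondegenerate Φ := fun hnd =>
    hb0 ((isNondegenerate_iff_forall_annihilator e hc Φ φ₀ T hread').1 hnd b hb hbann)
  obtain ⟨X, ι, ϑ, hX, hs, hdim⟩ := exists_simple_realisation_of_isPrimitive Φ φ₀ hprimΦ
  refine ⟨Φ, φ₀, X, ι, ϑ, hprimΦ, hdeg, hX, hs, ?_, exists_exceptional_pow_of_not_isNondegenerate φ₀ hprimΦ hdeg hX⟩
  rw [hdim, ← card_model_eq_finrank e]

end Field

end Summit.HodgeConjecture.CorCM.SplitInvolution

end
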